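import Summits.HodgeConjecture.HodgeConjecture.Theorems.LimitExtensionHypersurfaceHodgeFourLowDegreeOfSpanning
import Literature.AlgebraicGeometry.HodgeTheory.TopHodgeClassesSpannedByPullbacksHolds
import Literature.AlgebraicGeometry.HodgeTheory.ComplexOrientationDegreeFormulaHolds

/-!
# Route LimitExtension — `HypersurfaceHodgeFourLowDegree` PROVED

The crux `HypersurfaceHodgeFourLowDegree` of route `LimitExtension` (stmt-HodgeConjecture-3003): the Hodge
conjecture for smooth hypersurface fourfolds `X ⊂ ℙ⁵` of degree `d ≤ 5` (Zucker 1977 for cubics, Conte–Murre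
1978 / Murre for quartics and quintics: such fourfolds are covered by lines / rationally connected, so
`CH₀` is degenerate and Bloch–Srinivas applies). The tree reduced it to the two named facts behind the
complex-orientation Gysin formalism (`limitExtension_hypersurfaceHodgeFourLowDegree_of_degreeFormula_of_spanning`,
seat prover-pitem-stmt-HodgeConjecture-3003-c6); both are theorems since 2026-08-17
(`topHodgeClasses_spanned_by_pullbacks_holds`, p145587; `Fulton1998_degreeFormula_complexOrientation_holds`,
p147912 — lead c2 of the crux line `regime-split-middle-step` of `CurveNetMordellWeil.VerticalSupportMiddle`),
so the item closes.

## References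

* [Zucker1977] S. Zucker, The Hodge conjecture for cubic fourfolds, Compositio Math. 34 (1977).
* [ConteMurre1978] A. Conte, J. P. Murre, The Hodge conjecture for fourfolds admitting a covering by rational
  curves, Math. Ann. 238 (1978).
* [VoisinHodgeII2003] C. Voisin, Hodge Theory and Complex Algebraic Geometry II, Prop. 10.26.
-/

noncomputable section

-- `Summit.HodgeConjecture.HodgeConjecture.Theorems` is the mandated namespace (single-problem summit),
-- flagged by `linter.dupNamespace`; the lakefile turns the linter off tree-wide, restated for stand-alone runs.
set_option linter.dupNamespace false

open Literature.AlgebraicGeometry.HodgeTheory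

namespace Summit.HodgeConjecture.HodgeConjecture.Theorems

/-- **The Hodge conjecture for smooth hypersurface fourfolds of degree `≤ 5`, PROVED** (route decl
`LimitExtension.HypersurfaceHodgeFourLowDegree` by name): the tree's reduction to Fulton's degree formula and
the spanning of top `(d,d)`-classes by pull-backs, with both facts discharged. [cite: Zucker1977]
[cite: ConteMurre1978] [cite: VoisinHodgeII2003, Prop. 10.26] -/
theorem hypersurfaceHodgeFourLowDegree_proof :
    Summit.HodgeConjecture.HodgeConjecture.Theses.LimitExtension.HypersurfaceHodgeFourLowDegree :=
  limitExtension_hypersurfaceHodgeFourLowDegree_of_degreeFormula_of_spanning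
    Fulton1998_degreeFormula_complexOrientation_holds topHodgeClasses_spanned_by_pullbacks_holds

end Summit.HodgeConjecture.HodgeConjecture.Theorems

end
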